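import Summits.ABC.IUTFork.Thm311RealInd1StripGlobalStrictnessDyadicWitness
import Summits.ABC.IUTFork.Thm311RealInd1StripGlobalDichotomyUnion
import HarnessLib

/-!
# Row «C:PSI5-INPUT-WITNESS-STRIPMOVES» (R38b): R36 (ψ5)'s binder class inhabited at the input level WITH THE PRIME-INDEXED STRIP-MOVES FAMILY
# `H⋆ ≤ indTwo` (not the trivial family) — over `ℚ(√−1) = CyclotomicField 4 ℚ`, R32 §1's global identity (P) FAILS AS TYPED for `H⋆` (closed)

Proof-only file of the abc-iut cell (upgrade of the GUARD ROW R38 ★ p617014 for R36 (ψ5) ★ p606976; C LEAD ruling on the live seat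
abc-iut-f-193 GEN 35's OFFER R38b).  Statements about OUR typed inputs / packets / reading (P) only; inhabited ≠ discharged; typed ≠ proved;
calibrated ≠ discharged; TAKES NO SIDE on [IUTchIII] Cor. 3.12 / [IUTchIV] Thm. 1.10, on reading (U) vs (P), or on any author; NO abc claim.

WHAT.  R38 (`Thm311RealInd1StripGlobalStrictnessDyadicWitness`) exhibits a genuine Θ-volume input `I` over `K = F₀ = ℚ(√−1)` with every section
place over `2` of local degree `2` and instantiates (ψ5) with the TRIVIAL strip family `H ≡ ⊥` (C LEAD desk guard G1).  Here the SAME witness is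
paired with abc-iut-c312-1's PRIME-INDEXED STRIP-MOVES FAMILY `H⋆` of `Thm311RealInd1StripGlobalDichotomyUnion`
(`ThetaVolumeInput.exists_primeIndexedFamily_le_indTwo_stripMoves_factorwise` — the family R31/R32's own non-vacuity theorem exhibits): at
every prime `p` and collection `(j, v⃗)`, `H⋆_{p,j,v⃗} ≤ indTwo`, `H⋆` CONTAINS every single-factor (Ind1) strip move, and every member ACTS
FACTORWISE through the closures of the realised (Ind1) strip groups — i.e. `H⋆` supplies (ψ5)'s `hH` AND `hHfac` BY NAME.  Hence (ψ5) fires at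
`(I, H⋆)`: the nonarchimedean Θ-side sum in reading (P) over `H⋆` is `≠` (indeed `<`) Dupuy–Hilado's `−|log(Θ)|^{(P),nonarch}` — a closed theorem,
no hypotheses, for a family that is the (Ind1)-generated part of print's (Ind1)⊔(Ind2) AS TYPED.  The «`H ≡ indTwo` itself, acting factorwise»
instance remains ISOLATED (not claimed).  ONE theorem carries both the strict `<` and (ψ5)'s displayed `≠`.

DICTIONARY: witness as in R38 (F₀ = K = CyclotomicField 4 ℚ, `s = ζ₄`, `S = V(K)_2`, `l = 5`, `j_E = 2^{−5}`, any place section, ideles by `exists_of_ordq`,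
`n = 1`); `(i₁, v⃗₁) = (0, constant at a chosen place over 2)`; `H⋆` = the Union file's family for THIS `I`. [cite: Mochizuki2012, IUTchIII Thm. 3.11 (i) p. 154;
Cor. 3.12 p. 174] [cite: DupuyHilado2025, Def. 3.6.3, §4.9, §4.11, §4.12] [claim: Mochizuki2012, status: disputed]  PROOF-ONLY: 0 def / instance / notation / Prop fact.
-/

set_option autoImplicit false

noncomputable section

open Metric Set Function Module
open scoped Pointwise TensorProduct

namespace Literature.IUT.LogVolume.ThetaVolumeInput

open Summit.ABC.IUTFork.Thm311.Real Literature.NumberTheory.NumberFields Function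
open Literature.NumberTheory.GaloisRepresentations Literature.NumberTheory.GaloisRepresentations.Ultrametric
open Literature.AnabelianGeometry.AbsoluteAnabelian Literature.IUT.HodgeArakelov
open Literature.IUT.HodgeArakelov.AbsTopMonoids NumberField IsDedekindDomain Summit.ABC.IUTFork.Joshi.PinsIsometricResidualLineGaussian

namespace DyadicWitness

/-- **R36 (ψ5) at the Gaussian input with the STRIP-MOVES family `H⋆ ≤ indTwo` (closed theorem, no hypotheses).**  There are a genuine Θ-volume input `I`
over `K = F₀ = ℚ(√−1) = CyclotomicField 4 ℚ` (every section place over `2` of local degree `2`) and a prime-indexed family `H` with: `H ≤ indTwo` at every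
`(p, j, v⃗)`; `H` CONTAINS every single-factor (Ind1) strip move (`ψ ∈ ind1StripOf` acting in factor `b₀`, the other factors fixed); every member of `H` ACTS
FACTORWISE through the closures of the realised (Ind1) strip groups; and the nonarchimedean Θ-side sum in reading (P) over `H` is STRICTLY BELOW — hence
`≠` — Dupuy–Hilado's `−|log(Θ)|^{(P),nonarch}` (both (ψ5) forms `_lt_` / `_ne_` BY NAME).  Inputs BY NAME: R38 §1 `exists_input_of_finrank_two_of_sq_eq_neg_one`, abc-iut-c312-1's
`exists_primeIndexedFamily_le_indTwo_stripMoves_factorwise` and (ψ5) `sum_lnνLp_hull_orbitH_{lt,ne}_negLogThetaPerImageNonarch_of_dyadicSqrtNegOne`.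
[claim: Mochizuki2012, status: disputed] [cite: Mochizuki2012, IUTchIII Thm. 3.11 (i) p. 154; Cor. 3.12 p. 174] [cite: DupuyHilado2025, §4.9, §4.12] -/
theorem exists_sum_lnνLp_hull_stripMoves_lt_and_ne_negLogThetaPerImageNonarch_gaussian :
    ∃ I : ThetaVolumeInput (CyclotomicField 4 ℚ) (CyclotomicField 4 ℚ),
    ∃ H : ∀ (p : ℕ) (hp : p.Prime), haveI : Fact p.Prime := ⟨hp⟩
      (j : ℕ) → (e : Fin (j + 1) → placesOver (CyclotomicField 4 ℚ) p) →
        Subgroup (PacketAlgebra p (fun b => (I.σ.localFields p).k (e b)) ≃ₗ[ℚ_[p]]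
          PacketAlgebra p (fun b => (I.σ.localFields p).k (e b))),
      (∀ w : placesOver (CyclotomicField 4 ℚ) 2, localDeg (CyclotomicField 4 ℚ) (I.σ.lift w.1) = 2) ∧
      (∀ (p : ℕ) (hp : p.Prime), haveI : Fact p.Prime := ⟨hp⟩;
        ∀ j e, H p hp j e ≤ indTwo p (fun b => (I.σ.localFields p).k (e b))) ∧
      (∀ (p : ℕ) (hp : p.Prime), haveI : Fact p.Prime := ⟨hp⟩;
        ∀ (i : Fin I.lstar) (e : Fin ((i : ℕ) + 1 + 1) → placesOver (CyclotomicField 4 ℚ) p) (b₀ : Fin ((i : ℕ) + 1 + 1)),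
          ∀ ψ ∈ ind1StripOf (I.σ.lift (e b₀).1) (galoisLog (I.σ.lift (e b₀).1)), ∃ γ ∈ H p hp ((i : ℕ) + 1) e,
            ∀ z : ∀ b, (I.σ.localFields p).k (e b),
              (γ : PacketAlgebra p (fun b => (I.σ.localFields p).k (e b)) ≃ₗ[ℚ_[p]]
                  PacketAlgebra p (fun b => (I.σ.localFields p).k (e b))) (PiTensorProduct.tprod ℚ_[p] z) =
                PiTensorProduct.tprod ℚ_[p] (update z b₀
                  (RescaledCompletion.of (CyclotomicField 4 ℚ) p (I.σ.lift (e b₀).1) (I.σ.natCast_mem_lift (e b₀))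
                    (ψ ((RescaledCompletion.of (CyclotomicField 4 ℚ) p (I.σ.lift (e b₀).1)
                      (I.σ.natCast_mem_lift (e b₀))).symm (z b₀)))))) ∧
      (∀ (p : ℕ) (hp : p.Prime), haveI : Fact p.Prime := ⟨hp⟩;
        ∀ (i : Fin I.lstar) (e : Fin ((i : ℕ) + 1 + 1) → placesOver (CyclotomicField 4 ℚ) p), ∀ γ ∈ H p hp ((i : ℕ) + 1) e,
          ∃ δ : Π b, AddAut ((I.σ.lift (e b).1).adicCompletion (CyclotomicField 4 ℚ)),
            (∀ b, δ b ∈ AddSubgroup.closure (G := AddAut ((I.σ.lift (e b).1).adicCompletion (CyclotomicField 4 ℚ)))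
              (ind1StripOf (I.σ.lift (e b).1) (galoisLog (I.σ.lift (e b).1)))) ∧
            ∀ z : Π b, (I.σ.localFields p).k (e b),
              (γ : PacketAlgebra p (fun b => (I.σ.localFields p).k (e b)) ≃ₗ[ℚ_[p]]
                  PacketAlgebra p (fun b => (I.σ.localFields p).k (e b))) (PiTensorProduct.tprod ℚ_[p] z) =
                PiTensorProduct.tprod ℚ_[p] (fun b => RescaledCompletion.of (CyclotomicField 4 ℚ) p (I.σ.lift (e b).1)
                  (I.σ.natCast_mem_lift (e b))
                  (δ b ((RescaledCompletion.of (CyclotomicField 4 ℚ) p (I.σ.lift (e b).1)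
                    (I.σ.natCast_mem_lift (e b))).symm (z b))))) ∧
      (∑ p ∈ I.supportPrimes, if hp : p.Prime then
          (haveI : Fact p.Prime := ⟨hp⟩
          (I.packetAt p hp).lnνLp I.lstar (fun j e =>
            packetHull p (fun b => (I.σ.localFields p).k (e b))
              (⋃ g : H p hp j e, (g : PacketAlgebra p (fun b => (I.σ.localFields p).k (e b)) ≃ₗ[ℚ_[p]]
                  PacketAlgebra p (fun b => (I.σ.localFields p).k (e b))) ''
                (I.packetAt p hp).pilotRegion (I.tΘ p hp) j e))) else 0) <
        I.negLogThetaPerImageNonarch ∧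
      (∑ p ∈ I.supportPrimes, if hp : p.Prime then
          (haveI : Fact p.Prime := ⟨hp⟩
          (I.packetAt p hp).lnνLp I.lstar (fun j e =>
            packetHull p (fun b => (I.σ.localFields p).k (e b))
              (⋃ g : H p hp j e, (g : PacketAlgebra p (fun b => (I.σ.localFields p).k (e b)) ≃ₗ[ℚ_[p]]
                  PacketAlgebra p (fun b => (I.σ.localFields p).k (e b))) ''
                (I.packetAt p hp).pilotRegion (I.tΘ p hp) j e))) else 0) ≠
        I.negLogThetaPerImageNonarch := by
  classical
  obtain ⟨hK, s, hs⟩ := cyclotomicField_four_finrank_and_sq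
  obtain ⟨I, -, hl, hd⟩ := exists_input_of_finrank_two_of_sq_eq_neg_one hK hs
  obtain ⟨H, hH, hstrip, hHfac⟩ := I.exists_primeIndexedFamily_le_indTwo_stripMoves_factorwise
  obtain ⟨v₂, hv₂⟩ := placesOver_nonempty (CyclotomicField 4 ℚ) 2
  have hlstar : 0 < I.lstar := by
    show 0 < (I.X.l - 1) / 2
    rw [hl]
    norm_num
  let i₁ : Fin I.lstar := ⟨0, hlstar⟩
  let e₁ : Fin ((i₁ : ℕ) + 1 + 1) → placesOver (CyclotomicField 4 ℚ) 2 := fun _ => ⟨v₂, hv₂⟩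
  exact ⟨I, H, hd, hH, hstrip, hHfac,
    I.sum_lnνLp_hull_orbitH_lt_negLogThetaPerImageNonarch_of_dyadicSqrtNegOne hs hd H hH i₁ e₁
      (hHfac 2 Nat.prime_two i₁ e₁),
    I.sum_lnνLp_hull_orbitH_ne_negLogThetaPerImageNonarch_of_dyadicSqrtNegOne hs hd H hH i₁ e₁
      (hHfac 2 Nat.prime_two i₁ e₁)⟩


end DyadicWitness

end Literature.IUT.LogVolume.ThetaVolumeInput

end
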